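import Summits.BirchSwinnertonDyer.BirchSwinnertonDyer.Theorems.OneSidedTwistSqueezeX9KatoDivisibilityX9ChebotarevPk
import Summits.BirchSwinnertonDyer.BirchSwinnertonDyer.Theorems.OneSidedTwistSqueezeX9KatoDivisibilityX9GraphPairingDefect
import Summits.BirchSwinnertonDyer.BirchSwinnertonDyer.Theorems.OneSidedTwistSqueezeX9KatoDivisibilityX9DefectLevels
import Summits.BirchSwinnertonDyer.BirchSwinnertonDyer.Theorems.SmallImageMuTransferMuTransferX9ModPTwistSubmodules
import HarnessLib

set_option autoImplicit false

-- the summit and its single problem are both named `BirchSwinnertonDyer` (registry layout D-0017)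
set_option linter.dupNamespace false

/-!
# Stub 1b `stub_kolyvaginPrimePkX9` of line `graded_euler_loss` (crux `KatoDivisibilityX9` =
# stmt-BirchSwinnertonDyer-20547): TEST PAIR ↦ KOLYVAGIN PRIME at `p`-level `d+1` —
# Lemma 5.7.B WITH DEFECT on the joint kernel cut down to `ker ρ_{E,p^{d+1}}`, then Chebotarev

Seat `bsd-line-k6-p4` (prover-bsd-line-k6-p4-g5-0, 5th LEAD on crux stmt-BirchSwinnertonDyer-20547; route
`OneSidedTwistSqueezeX9`; host cell `bsd-f3-mu`).  THEOREMS ONLY, sorry-free, no definition, no named fact;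
`--supports stmt-BirchSwinnertonDyer-20547` (registered stub `stub_kolyvaginPrimePkX9` of skeleton v3, sha16
380b9845780dc615, = hypothesis `h12` of the landed graded assembly
`…GradedCoreAssembly.fineCoreGraded_of_testCocycle_of_kolyvaginPrime_of_reciprocity`).

THE ARGUMENT (HOME/MEMO-es §15 STEP 1–2 at `p`-level `d+1`; card `Lines/graded_euler_loss.md`, g4 plan (a)–(e)).
Let `e = p^N`, `H = N_e(κ) ⊓ N_e(κ⁻¹)` (joint kernel of the two mod-`p` twists `𝒯_e(E, κ^{±1})`),
`K = ker ρ_{E,p^{d+1}}`, `H' = H ⊓ K`, `B = [Γ_ℚ : K]`.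
* (a) DEFECT LEVELS.  `φ(H')` and `ψ(H')` are `Γ_ℚ`-stable subgroups of `𝒯_e` (`H'` normal), hence of the
  form `T^{c₁}𝒯_e`, `T^{c₂}𝒯_e` (Lemma 3 (i) on the genuine module, `LevelE.modPTwist_stable_addSubgroup_eq_tPow`,
  irreducibility of `E[p]` only); and `c_i + 1 ≤ [𝒯_e : T^{c_i}𝒯_e] ∣ [H : H'] ∣ B` because `φ(H) = ψ(H) = 𝒯_e`
  (the `n = 0` STEP 1, `LevelE.valueSubgroup_inf_eq_top_of_towerConst_ne_zero_of_ne_two` /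
  `…_of_shiftH1_iterate_ne_zero_of_ne_two`) — so `c₁, c₂ ≤ B − 1`, uniformly in `e, κ', φ, ψ`.
* (b)–(c) POLARISATION with decoupled slots (`LevelE.exists_mem_coeff_ne_zero_of_polarisation₂`, p614716) on the
  joint value module `M' = (φ, ψ)(H')` with `x`-slots `(c₁, c₁+1)`, `y`-slots `(c₂, c₂+1)`: `γ₀ − 1 = (S, −S·U)` for a
  topological generator `γ₀` fixing `E[p]`.
* (d) READ-OFF: for `x ∈ T^{c₁}𝒯_e`, `y ∈ T^{c₂}𝒯_e` the Weil convolution coefficients are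
  `C_{c₁+c₂}(x, y) = e_W(x_{c₁}, y_{c₂})`, `C_{c₁+c₂+1}(x, y) = e_W(x_{c₁}, y_{c₂+1}) + e_W(x_{c₁+1}, y_{c₂})`; one is
  non-zero, `j ≤ 2B − 1 ≤ c₀ + 1` with `c₀ := 2B`.
* (e) CHEBOTAREV at the joint value (`…ChebotarevPk.exists_threshold_isArithFrobAt_mem_apply_eq_and_depth_pk_of_ne_two`,
  `k = d + 1`; threshold `n₁`), `N₁ := max n₁ (2B + 1)`.
The slot algebra, the index bound for defect levels and the read-off identities are the sibling helper file
`…KatoDivisibilityX9DefectLevels.lean` (same seat).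

HONEST LABEL: closes the registered stub 1b of the DEPTH obligation; stubs 1a / 1c / width / F1_ζ and the crux stay
OPEN; PARTITION untouched; beyond-print theorem toward BSD: NO; no summit statement is proved by this seat; BSD is
not proved by any of this.

References: B. Mazur, K. Rubin, Mem. AMS 799 (2004) §4.4, §5.3 [MazurRubin2004]; J.-P. Serre, Invent. Math. 15 (1972)
§2.4 Prop. 15, §2.6 [Serre1972]; J. Tate in Cassels–Fröhlich VII §2.4 [TateGCFT1967]; B. Howard, Compositio 140 (2004)
Prop. 3.2.4 [Howard2004HeegnerKolyvagin]; HOME/MEMO-es.md §15, §21 (A8), §25.7.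
-/

noncomputable section

open scoped Classical NumberField ContRepresentation
open WeierstrassCurve Field IsDedekindDomain Function
open Literature.NumberTheory.GaloisRepresentations
open Literature.NumberTheory.GaloisCohomology
open Literature.NumberTheory.EllipticCurves
open Summit.BirchSwinnertonDyer.BirchSwinnertonDyer.Rank1Residual
open Summit.BirchSwinnertonDyer.BirchSwinnertonDyer.Theorems.OneSidedTwistSqueezeX9KatoDivisibilityX9ChebotarevPk
open Summit.BirchSwinnertonDyer.BirchSwinnertonDyer.Theorems.OneSidedTwistSqueezeX9KatoDivisibilityX9DefectLevels

namespace Summit.BirchSwinnertonDyer.BirchSwinnertonDyer.Theorems.OneSidedTwistSqueezeX9KatoDivisibilityX9StubKolyvaginPrimePkX9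

/-! ## §1 STEP 1 WITH DEFECT on `H' = N_e(κ) ⊓ N_e(κ⁻¹) ⊓ ker ρ_{E,p^k}` -/

section Defect

/-- **MU-TRANSFER-PROOF §5 STEP 1 + §4 LEMMA 4 WITH DEFECT (Lemma 5.7.B with defect), at `p`-level `k`.**
`p` odd, `E[p]` irreducible, `ρ̄_{E,p}` not onto; `κ' ∈ 𝐇¹_Ω` with `κ̄' ≠ 0`, `φ` a cocycle of `κ'_e`, `ψ` a cocycle
of the dual twist with `T^{e−1}[ψ] ≠ 0`, `e = e' + 1 ≥ 2B + 1` where `B = [Γ_ℚ : ker ρ_{E,p^k}]`, `e_W` a Weil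
pairing.  Then some joint value `z = (φ τ, ψ τ)` with `τ ∈ H' = N_e(κ) ⊓ N_e(κ⁻¹) ⊓ ker ρ_{E,p^k}` has a
non-vanishing Weil convolution coefficient `C_j(z₁, z₂) ≠ 0` of index `j ≤ 2B − 1` (`j = c₁ + c₂` or
`c₁ + c₂ + 1`, `c_i` the defect levels of `φ(H') = T^{c₁}𝒯_e`, `ψ(H') = T^{c₂}𝒯_e`, `c_i + 1 ≤ B`).
At `k = 0` (`H' = H`, `B = 1`) this is the landed `CoreAssembly.exists_jointValue_weil_ne_zero_of_ne_two`.
[cite: MazurRubin2004, §4.4 and §5.3] [cite: Serre1972, §2.4 Prop. 15 and §2.6]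
[cite: Howard2004HeegnerKolyvagin, Prop. 3.2.4] -/
theorem exists_jointValue_convCoeff_ne_zero_of_ne_two (W : WeierstrassCurve ℚ) [W.IsElliptic]
    (p : ℕ) [Fact p.Prime] (κ : ZpExtension ℚ p) {γ : absoluteGaloisGroup ℚ}
    (hp2 : p ≠ 2) (hirr : W.HasIrreducibleModPGaloisRep p) (hns : ¬ W.HasSurjectiveModNGaloisRep p)
    (hγ : κ.IsTopGenerator γ) (k : ℕ)
    (κ' : κ.twistTower (W.torsionGaloisModule (p : ℤ))
      (fun P : geomTorsion W (p : ℤ) => AddSubgroup.torsionBy.nsmul P))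
    (hκ'c : κ.towerConst (W.torsionGaloisModule (p : ℤ)) (fun P => AddSubgroup.torsionBy.nsmul P) κ' ≠ 0)
    {e' : ℕ} (he : 2 * (galoisRepTorsion W ((p : ℤ) ^ k)).ker.index + 1 ≤ e' + 1)
    (φ : contOneCocycles (W.modPTwist p κ (e' + 1)).toTopRep)
    (hφ : oneCocycleClass (W.modPTwist p κ (e' + 1)).toTopRep φ = κ'.1 (e' + 1))
    (ψ : contOneCocycles (W.modPTwist p κ.invTwist (e' + 1)).toTopRep)
    (hψT : (κ.invTwist.shiftH1 (W.torsionGaloisModule (p : ℤ))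
      (fun P : geomTorsion W (p : ℤ) => AddSubgroup.torsionBy.nsmul P) (e' + 1))^[e']
        (oneCocycleClass (W.modPTwist p κ.invTwist (e' + 1)).toTopRep ψ) ≠ 0)
    (eW : geomTorsion W (p : ℤ) → geomTorsion W (p : ℤ) → AlgebraicClosure ℚ)
    (hμ : ∀ S T, eW S T ^ p = 1) (hadd₁ : ∀ S₁ S₂ T, eW (S₁ + S₂) T = eW S₁ T * eW S₂ T)
    (hadd₂ : ∀ S T₁ T₂, eW S (T₁ + T₂) = eW S T₁ * eW S T₂) (hnondeg : ∀ T, (∀ S, eW S T = 1) → T = 0) :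
    ∃ z ∈ contOneCocycles.jointValueSubgroup φ ψ
      (((κ.twistModPRepresentation (W.torsionGaloisModule (p : ℤ))
          (fun P : geomTorsion W (p : ℤ) => AddSubgroup.torsionBy.nsmul P) (e' + 1)).ker ⊓
        (κ.invTwist.twistModPRepresentation (W.torsionGaloisModule (p : ℤ))
          (fun P : geomTorsion W (p : ℤ) => AddSubgroup.torsionBy.nsmul P) (e' + 1)).ker) ⊓
        (galoisRepTorsion W ((p : ℤ) ^ k)).ker)
      (fun _ hτ x => κ.toTopRep_ρ_apply_eq_self_of_mem_ker (W.torsionGaloisModule (p : ℤ)) _ (e' + 1)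
        (Subgroup.mem_inf.mp (Subgroup.mem_inf.mp hτ).1).1 x)
      (fun _ hτ y => κ.invTwist.toTopRep_ρ_apply_eq_self_of_mem_ker (W.torsionGaloisModule (p : ℤ)) _
        (e' + 1) (Subgroup.mem_inf.mp (Subgroup.mem_inf.mp hτ).1).2 y),
      ∃ j : ℕ, j + 1 ≤ 2 * (galoisRepTorsion W ((p : ℤ) ^ k)).ker.index ∧ j < e' + 1 ∧
        convCoeff (weilPairingHom W p eW hμ hadd₁ hadd₂) (e' + 1) j z.1 z.2 ≠ 0 := by
  have hp : p.Prime := Fact.out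
  haveI : Finite (geomTorsion W (p : ℤ)) :=
    finite_torsionPoints_holds W (AlgebraicClosure ℚ) (by exact_mod_cast hp.ne_zero)
  haveI : NeZero p := ⟨hp.ne_zero⟩
  -- the subgroups `K = ker ρ_{E,p^k}` (index `B`), `H = N_e(κ) ⊓ N_e(κ⁻¹)`, `H' = H ⊓ K`
  set K : Subgroup (absoluteGaloisGroup ℚ) := (galoisRepTorsion W ((p : ℤ) ^ k)).ker with hKdef
  haveI hKn : K.Normal := by rw [hKdef]; infer_instance
  have hB : K.index ≠ 0 := by
    haveI : Finite (geomTorsion W ((p : ℤ) ^ k)) :=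
      finite_torsionPoints_holds W (AlgebraicClosure ℚ) (pow_ne_zero _ (by exact_mod_cast hp.ne_zero))
    rw [hKdef, Subgroup.index_ker]
    exact Nat.card_pos.ne'
  have hγ' : κ.invTwist.IsTopGenerator γ⁻¹ := LevelE.isTopGenerator_invTwist_inv κ hγ
  set H : Subgroup (absoluteGaloisGroup ℚ) :=
    (κ.twistModPRepresentation (W.torsionGaloisModule (p : ℤ))
        (fun P : geomTorsion W (p : ℤ) => AddSubgroup.torsionBy.nsmul P) (e' + 1)).ker ⊓
      (κ.invTwist.twistModPRepresentation (W.torsionGaloisModule (p : ℤ))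
        (fun P : geomTorsion W (p : ℤ) => AddSubgroup.torsionBy.nsmul P) (e' + 1)).ker
    with hHdef
  have hX : ∀ τ ∈ H, ∀ x : (W.modPTwist p κ (e' + 1)).toTopRep,
      (W.modPTwist p κ (e' + 1)).toTopRep.ρ τ x = x := fun _ hτ x =>
    κ.toTopRep_ρ_apply_eq_self_of_mem_ker (W.torsionGaloisModule (p : ℤ)) _ (e' + 1)
      (Subgroup.mem_inf.mp hτ).1 x
  have hY : ∀ τ ∈ H, ∀ y : (W.modPTwist p κ.invTwist (e' + 1)).toTopRep,
      (W.modPTwist p κ.invTwist (e' + 1)).toTopRep.ρ τ y = y := fun _ hτ y =>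
    κ.invTwist.toTopRep_ρ_apply_eq_self_of_mem_ker (W.torsionGaloisModule (p : ℤ)) _ (e' + 1)
      (Subgroup.mem_inf.mp hτ).2 y
  have hX' : ∀ τ ∈ H ⊓ K, ∀ x : (W.modPTwist p κ (e' + 1)).toTopRep,
      (W.modPTwist p κ (e' + 1)).toTopRep.ρ τ x = x := fun τ hτ x => hX τ (Subgroup.mem_inf.mp hτ).1 x
  have hY' : ∀ τ ∈ H ⊓ K, ∀ y : (W.modPTwist p κ.invTwist (e' + 1)).toTopRep,
      (W.modPTwist p κ.invTwist (e' + 1)).toTopRep.ρ τ y = y := fun τ hτ y => hY τ (Subgroup.mem_inf.mp hτ).1 y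
  -- STEP 1 at `n = 0`: both value groups on `H` are everything
  have hφtop : contOneCocycles.valueSubgroup φ H hX = ⊤ :=
    LevelE.valueSubgroup_inf_eq_top_of_towerConst_ne_zero_of_ne_two W p κ κ.invTwist hp2 hirr hns hγ κ'
      hκ'c e' (e' + 1) φ hφ
  have hψtop : contOneCocycles.valueSubgroup ψ H hY = ⊤ :=
    LevelE.valueSubgroup_inf_eq_top_of_shiftH1_iterate_ne_zero_of_ne_two W p κ κ.invTwist hp2 hirr hns hγ'
      (e' + 1) e' ψ hψT
  haveI hHn : (H ⊓ K).Normal := by rw [hHdef]; infer_instance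
  have hrel : (H ⊓ K).relIndex H ∣ K.index := by
    rw [Subgroup.inf_relIndex_left]
    exact Subgroup.relIndex_dvd_index_of_normal _ _
  -- a topological generator `γ₀` fixing `E[p]`
  obtain ⟨γ₀, hγ₀, hγ₀E⟩ :=
    exists_isTopGenerator_forall_smul_eq_of_irreducible_of_not_surjective W p κ hirr hns
  have hγ₀' : κ.invTwist.IsTopGenerator γ₀⁻¹ := LevelE.isTopGenerator_invTwist_inv κ hγ₀
  have hγ₀E' : ∀ P : geomTorsion W (p : ℤ), γ₀⁻¹ • P = P := fun P => by
    rw [inv_smul_eq_iff, hγ₀E]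
  -- (a) DEFECT LEVELS: `φ(H') = T^{c₁}𝒯_e`, `ψ(H') = T^{c₂}𝒯_e`, `c_i + 1 ≤ B`
  obtain ⟨c₁, hc₁e, hP₁⟩ := LevelE.modPTwist_stable_addSubgroup_eq_tPow W p κ (e' + 1) hirr hγ₀ hγ₀E
    (contOneCocycles.valueSubgroup φ (H ⊓ K) hX')
    (fun σ _ hx => contOneCocycles.smul_mem_valueSubgroup φ (H ⊓ K) hX' σ hx)
  obtain ⟨c₂, hc₂e, hP₂⟩ := LevelE.modPTwist_stable_addSubgroup_eq_tPow W p κ.invTwist (e' + 1) hirr hγ₀'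
    hγ₀E' (contOneCocycles.valueSubgroup ψ (H ⊓ K) hY')
    (fun σ _ hy => contOneCocycles.smul_mem_valueSubgroup ψ (H ⊓ K) hY' σ hy)
  haveI : Nontrivial (geomTorsion W (p : ℤ)) := by
    have hcard : 1 < Nat.card (geomTorsion W (p : ℤ)) := by
      rw [W.natCard_geomTorsion (n := (p : ℤ)) (by exact_mod_cast hp.ne_zero), Int.natAbs_natCast]
      nlinarith [hp.one_lt]
    exact Finite.one_lt_card_iff_nontrivial.mp hcard
  have hc₁B : c₁ + 1 ≤ K.index :=
    (succ_le_index_of_forall_lt hc₁e _ hP₁).trans (Nat.le_of_dvd (Nat.pos_of_ne_zero hB)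
      ((index_valueSubgroup_dvd_relIndex φ H (H ⊓ K) inf_le_left hX hφtop).trans hrel))
  have hc₂B : c₂ + 1 ≤ K.index :=
    (succ_le_index_of_forall_lt hc₂e _ hP₂).trans (Nat.le_of_dvd (Nat.pos_of_ne_zero hB)
      ((index_valueSubgroup_dvd_relIndex ψ H (H ⊓ K) inf_le_left hY hψtop).trans hrel))
  have hc₁lt : c₁ + 1 < e' + 1 := by omega
  have hc₂lt : c₂ + 1 < e' + 1 := by omega
  -- the joint value module `M'` and its `ZMod p`-linear repackaging
  classical
  letI : Module (ZMod p) (geomTorsion W (p : ℤ)) := AddSubgroup.torsionBy.zmodModule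
  set Mj := contOneCocycles.jointValueSubgroup φ ψ (H ⊓ K) hX' hY' with hMjdef
  let Mk : Submodule (ZMod p)
      ((Fin (e' + 1) → geomTorsion W (p : ℤ)) × (Fin (e' + 1) → geomTorsion W (p : ℤ))) :=
    AddSubgroup.toZModSubmodule p Mj
  have hMkmem : ∀ z, z ∈ Mk ↔ z ∈ Mj := fun z => AddSubgroup.mem_toZModSubmodule p
  -- the operators `γ₀ − 1` on the two twists: `T = S`, `D = −S·U`
  let T : (Fin (e' + 1) → geomTorsion W (p : ℤ)) →ₗ[ZMod p] (Fin (e' + 1) → geomTorsion W (p : ℤ)) :=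
    ((W.modPTwist p κ (e' + 1) γ₀).toAddMonoidHom - AddMonoidHom.id _).toZModLinearMap p
  let D : (Fin (e' + 1) → geomTorsion W (p : ℤ)) →ₗ[ZMod p] (Fin (e' + 1) → geomTorsion W (p : ℤ)) :=
    ((W.modPTwist p κ.invTwist (e' + 1) γ₀).toAddMonoidHom - AddMonoidHom.id _).toZModLinearMap p
  have hfix : ∀ x : Fin (e' + 1) → geomTorsion W (p : ℤ),
      (fun i => W.torsionGaloisModule (p : ℤ) γ₀ (x i)) = x := fun x =>
    funext fun i => by rw [WeierstrassCurve.torsionGaloisModule_apply_apply, hγ₀E]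
  have hTapply : ∀ x, T x =
      W.modPTwist p κ (e' + 1) γ₀ x - fun i => W.torsionGaloisModule (p : ℤ) γ₀ (x i) :=
    fun x => by rw [hfix]; rfl
  have hDapply : ∀ y, D y =
      W.modPTwist p κ.invTwist (e' + 1) γ₀ y - fun i => W.torsionGaloisModule (p : ℤ) γ₀ (y i) :=
    fun y => by rw [hfix]; rfl
  have hTS : ∀ x, T x = shiftEnd (geomTorsion W (p : ℤ)) (e' + 1) x := fun x => by
    rw [hTapply]
    refine (ZpExtension.twistModP_apply_sub_of_isTopGenerator κ _ _ (e' + 1) hγ₀ x).trans ?_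
    rw [hfix]
  have hDS : ∀ y, D y = -(shiftEnd (geomTorsion W (p : ℤ)) (e' + 1)
      (unipotentPow (geomTorsion W (p : ℤ)) (e' + 1) (κ.invTwist.twistExponent (e' + 1) γ₀) y)) :=
    fun y => by
    rw [hDapply]
    refine (LevelE.invTwist_twistModP_apply_sub_of_isTopGenerator κ _ _ (e' + 1) hγ₀ y).trans ?_
    rw [hfix]
  have hMkT : ∀ z ∈ Mk, (T z.1, D z.2) ∈ Mk := by
    intro z hz
    rw [hMkmem] at hz ⊢
    exact LevelE.sub_mem_of_prod_stable (W.modPTwist p κ (e' + 1) γ₀).toAddMonoidHom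
      (W.modPTwist p κ.invTwist (e' + 1) γ₀).toAddMonoidHom Mj (fun w hw =>
        contOneCocycles.smul_mem_jointValueSubgroup φ ψ (H ⊓ K) hX' hY' γ₀ hw) hz
  -- coordinates: both components of a joint value vanish below the defect levels
  have hMc1 : ∀ z ∈ Mk, ∀ i : Fin (e' + 1), (i : ℕ) < c₁ → z.1 i = 0 := fun z hz =>
    (hP₁ z.1).mp (by
      obtain ⟨τ, hτ, hz'⟩ := (hMkmem z).mp hz
      exact ⟨τ, hτ, congrArg Prod.fst hz'⟩)
  have hMc2 : ∀ z ∈ Mk, ∀ i : Fin (e' + 1), (i : ℕ) < c₂ → z.2 i = 0 := fun z hz =>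
    (hP₂ z.2).mp (by
      obtain ⟨τ, hτ, hz'⟩ := (hMkmem z).mp hz
      exact ⟨τ, hτ, congrArg Prod.snd hz'⟩)
  have hT0 : ∀ z ∈ Mk, T z.1 ⟨c₁, by omega⟩ = 0 := fun z hz => by
    rw [hTS, shiftEnd_apply]
    by_cases h0 : c₁ = 0
    · rw [dif_pos (by simpa using h0)]
    · rw [dif_neg (by simpa using h0)]
      exact hMc1 z hz _ (by simp only; omega)
  have hT1 : ∀ z ∈ Mk, T z.1 ⟨c₁ + 1, hc₁lt⟩ = z.1 ⟨c₁, by omega⟩ := fun z _ => by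
    rw [hTS, shiftEnd_apply, dif_neg (by simp)]
    congr 1
  have hD0 : ∀ z ∈ Mk, D z.2 ⟨c₂, by omega⟩ = 0 := fun z hz => by
    rw [hDS, Pi.neg_apply, neg_eq_zero, shiftEnd_apply]
    by_cases h0 : c₂ = 0
    · rw [dif_pos (by simpa using h0)]
    · rw [dif_neg (by simpa using h0),
        unipotentPow_apply_of_forall_lt _ _ (hMc2 z hz) _ (by simp only; omega)]
      exact hMc2 z hz _ (by simp only; omega)
  have hD1 : ∀ z ∈ Mk, D z.2 ⟨c₂ + 1, hc₂lt⟩ = -z.2 ⟨c₂, by omega⟩ := fun z hz => by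
    rw [hDS, Pi.neg_apply, shiftEnd_apply, dif_neg (by simp),
      unipotentPow_apply_of_forall_lt _ _ (hMc2 z hz) _ (by simp)]
    congr 2
  -- slot `c₁` of the first projection and slot `c₂` of the second projection are everything
  have h1M : ∀ v : geomTorsion W (p : ℤ), ∃ z ∈ Mk, z.1 ⟨c₁, by omega⟩ = v := fun v => by
    have hv : (Pi.single (⟨c₁, by omega⟩ : Fin (e' + 1)) v : Fin (e' + 1) → geomTorsion W (p : ℤ)) ∈
        contOneCocycles.valueSubgroup φ (H ⊓ K) hX' := by
      rw [hP₁]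
      intro i hi
      rw [Pi.single_apply, if_neg]
      rintro rfl
      simp at hi
    obtain ⟨z, hz, hz1⟩ := (contOneCocycles.fst_jointValueSubgroup φ ψ (H ⊓ K) hX' hY' _).mp hv
    exact ⟨z, (hMkmem z).mpr hz, by rw [hz1]; simp⟩
  have h2M : ∀ v : geomTorsion W (p : ℤ), ∃ z ∈ Mk, z.2 ⟨c₂, by omega⟩ = v := fun v => by
    have hv : (Pi.single (⟨c₂, by omega⟩ : Fin (e' + 1)) v : Fin (e' + 1) → geomTorsion W (p : ℤ)) ∈
        contOneCocycles.valueSubgroup ψ (H ⊓ K) hY' := by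
      rw [hP₂]
      intro i hi
      rw [Pi.single_apply, if_neg]
      rintro rfl
      simp at hi
    obtain ⟨z, hz, hz2⟩ := (contOneCocycles.snd_jointValueSubgroup φ ψ (H ⊓ K) hX' hY' _).mp hv
    exact ⟨z, (hMkmem z).mpr hz, by rw [hz2]; simp⟩
  -- the Weil pairing as a `ZMod p`-valued bilinear form (`μ_p ≃ ℤ/p`), not identically zero
  set eWH := weilPairingHom W p eW hμ hadd₁ hadd₂ with heWH
  set ι := muCarrierZModEquiv ℚ p with hι
  set evAdd : geomTorsion W (p : ℤ) →+ geomTorsion W (p : ℤ) →+ ZMod p :=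
    eWH.flip.compr₂ ι.toAddMonoidHom with hevAdd
  let ev : geomTorsion W (p : ℤ) →ₗ[ZMod p] geomTorsion W (p : ℤ) →ₗ[ZMod p] ZMod p :=
    LinearMap.mk₂ (ZMod p) (fun y v => evAdd y v)
      (fun y₁ y₂ v => by rw [evAdd.map_add]; rfl)
      (fun c y v => ZMod.map_smul (evAdd.flip v) c y)
      (fun y v₁ v₂ => (evAdd y).map_add v₁ v₂)
      (fun c y v => ZMod.map_smul (evAdd y) c v)
  have hev_apply : ∀ y v, ev y v = ι (eWH v y) := fun _ _ => rfl
  have hev : ∃ y v, ev y v ≠ 0 := by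
    obtain ⟨T₀, hT₀⟩ := exists_ne (0 : geomTorsion W (p : ℤ))
    have hS : ∃ S, eW S T₀ ≠ 1 := by
      by_contra h
      push Not at h
      exact hT₀ (hnondeg T₀ h)
    obtain ⟨S, hS⟩ := hS
    refine ⟨T₀, S, ?_⟩
    rw [hev_apply]
    intro h0
    apply hS
    have h1 : eWH S T₀ = 0 := ι.map_eq_zero_iff.mp h0
    rw [heWH, muCarrier_eq_iff, coe_weilPairingHom] at h1
    exact h1
  have h2k : (2 : ZMod p) ≠ 0 := by
    have h : ((2 : ℕ) : ZMod p) ≠ 0 := by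
      rw [Ne, ZMod.natCast_eq_zero_iff]
      intro hdvd
      have := Nat.le_of_dvd two_pos hdvd
      have := hp.two_le
      omega
    exact_mod_cast h
  -- (b)–(c) POLARISATION with decoupled slots `(c₁, c₁+1)`, `(c₂, c₂+1)`
  obtain ⟨z, hzM, hz01⟩ := LevelE.exists_mem_coeff_ne_zero_of_polarisation₂ h2k
    (⟨c₁, by omega⟩ : Fin (e' + 1)) ⟨c₁ + 1, hc₁lt⟩ (⟨c₂, by omega⟩ : Fin (e' + 1)) ⟨c₂ + 1, hc₂lt⟩
    ev hev Mk (fun z hz => ⟨(T z.1, D z.2), hMkT z hz, hT0 z hz, hT1 z hz, hD0 z hz, hD1 z hz⟩) h1M h2M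
  -- (d) READ-OFF of `C_{c₁+c₂}` / `C_{c₁+c₂+1}`
  refine ⟨z, (hMkmem z).mp hzM, ?_⟩
  have hx0 := hMc1 z hzM
  have hy0 := hMc2 z hzM
  rw [hev_apply, hev_apply, hev_apply, ← map_add] at hz01
  rcases hz01 with h0 | h1
  · refine ⟨c₁ + c₂, by omega, by omega, ?_⟩
    rw [convCoeff_add_eq_of_forall_lt eWH (by omega) z.1 z.2 hx0 hy0]
    exact fun h => h0 (by rw [h, map_zero])
  · refine ⟨c₁ + c₂ + 1, by omega, by omega, ?_⟩
    rw [convCoeff_add_succ_eq_of_forall_lt eWH (by omega) z.1 z.2 hx0 hy0]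
    exact fun h => h1 (by rw [add_comm, h, map_zero])

end Defect

/-! ## §2 The registered stub `stub_kolyvaginPrimePkX9` (hypothesis `h12` of the graded assembly) -/

section Stub

open scoped NumberField

/-- **STUB 1b of line `graded_euler_loss` — TEST PAIR ↦ KOLYVAGIN PRIME at `p`-level `d+1`** (verbatim the
registered signature = hypothesis `h12` of `…GradedCoreAssembly.fineCoreGraded_of_testCocycle_of_kolyvaginPrime_of_reciprocity`).
Constants: `c₀ := 2·[Γ_ℚ : ker ρ_{E,p^{d+1}}]`, `N₁ := max n₁ (c₀ + 1)` with `n₁` the Chebotarev threshold of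
`…ChebotarevPk.exists_threshold_isArithFrobAt_mem_apply_eq_and_depth_pk_of_ne_two` (`k = d + 1`).  For `N ≥ N₁`,
`e = p^N`: STEP 1 with defect (`exists_jointValue_convCoeff_ne_zero_of_ne_two`) gives a joint value `w` on
`H' = N_e(κ) ⊓ N_e(κ⁻¹) ⊓ ker ρ_{E,p^{d+1}}` with `C_j(w) ≠ 0`, `j ≤ c₀ + 1`, `j < e`; the Chebotarev half realises
`w = (φ Fr, ψ Fr)` by an arithmetic Frobenius `Fr ∈ H'` at a prime `q ∉ S` with `ρ_{E,p^{d+1}}(Fr) = 1` and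
`Fr ∈ Gal(ℚ̄/ℚ_N) ∖ Gal(ℚ̄/ℚ_{N+1})`.  (The good-ordinary and cyclotomic binders of the registered signature are
not used.) [cite: Serre1972, §2.4 Prop. 15 and §2.6] [cite: TateGCFT1967, §2.4 (Tchebotarev density theorem)]
[cite: MazurRubin2004, §4.4 and §5.3] -/
theorem stub_kolyvaginPrimePkX9 : ∀ (W : WeierstrassCurve ℚ) [W.IsElliptic] [W.IsGloballyMinimal] (p : ℕ) [Fact p.Prime]
      (κ : ZpExtension ℚ p) (γ : absoluteGaloisGroup ℚ) (d : ℕ),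
      p ≠ 2 → W.HasGoodReductionAtPrime p → ¬ ((p : ℤ) ∣ W.frobeniusTrace p) →
      W.HasIrreducibleModPGaloisRep p → ¬ W.HasSurjectiveModNGaloisRep p →
      κ.IsCyclotomic → κ.IsTopGenerator γ →
      ∃ c₀ N₁ : ℕ, ∀ (N : ℕ), N₁ ≤ N → ∀ (e' : ℕ), e' + 1 = p ^ N →
        ∀ (κ' : κ.twistTower (W.torsionGaloisModule (p : ℤ))
            (fun P : geomTorsion W (p : ℤ) => AddSubgroup.torsionBy.nsmul P)),
          κ.towerConst (W.torsionGaloisModule (p : ℤ)) (fun P => AddSubgroup.torsionBy.nsmul P) κ' ≠ 0 →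
        ∀ (φ : contOneCocycles (W.modPTwist p κ (e' + 1)).toTopRep),
          oneCocycleClass (W.modPTwist p κ (e' + 1)).toTopRep φ = κ'.1 (e' + 1) →
        ∀ (ψ : contOneCocycles (W.modPTwist p κ.invTwist (e' + 1)).toTopRep),
          (κ.invTwist.shiftH1 (W.torsionGaloisModule (p : ℤ))
            (fun P : geomTorsion W (p : ℤ) => AddSubgroup.torsionBy.nsmul P) (e' + 1))^[e']
              (oneCocycleClass (W.modPTwist p κ.invTwist (e' + 1)).toTopRep ψ) ≠ 0 →
        ∀ (eW : geomTorsion W (p : ℤ) → geomTorsion W (p : ℤ) → AlgebraicClosure ℚ)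
          (hμ : ∀ S T, eW S T ^ p = 1) (hadd₁ : ∀ S₁ S₂ T, eW (S₁ + S₂) T = eW S₁ T * eW S₂ T)
          (hadd₂ : ∀ S T₁ T₂, eW S (T₁ + T₂) = eW S T₁ * eW S T₂),
          (∀ T, (∀ S, eW S T = 1) → T = 0) →
        ∀ (S : Set (HeightOneSpectrum (𝓞 ℚ))), S.Finite →
        ∃ q : HeightOneSpectrum (𝓞 ℚ), q ∉ S ∧ ∃ 𝔓 ∈ q.primesAbove, ∃ Fr : absoluteGaloisGroup ℚ,
          IsArithFrobAt (𝓞 ℚ) Fr 𝔓 ∧ galoisRepTorsion W ((p : ℤ) ^ (d + 1)) Fr = 1 ∧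
          Fr ∈ κ.layerSubgroup N ∧ Fr ∉ κ.layerSubgroup (N + 1) ∧
          ∃ j : ℕ, j ≤ c₀ + 1 ∧ j < e' + 1 ∧
            convCoeff (weilPairingHom W p eW hμ hadd₁ hadd₂) (e' + 1) j (φ.1 Fr) (ψ.1 Fr) ≠ 0 := by
  intro W _ _ p _ κ γ d hp2 _ _ hirr hns _ hγ
  have hp : p.Prime := Fact.out
  obtain ⟨n₁, hn₁⟩ := exists_threshold_isArithFrobAt_mem_apply_eq_and_depth_pk_of_ne_two W p κ hp2 hirr hns
    (k := d + 1) (by omega)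
  refine ⟨2 * (galoisRepTorsion W ((p : ℤ) ^ (d + 1))).ker.index,
    max n₁ (2 * (galoisRepTorsion W ((p : ℤ) ^ (d + 1))).ker.index + 1), ?_⟩
  intro N hN e' he κ' hκ'c φ hφ ψ hψT eW hμ hadd₁ hadd₂ hnondeg S hS
  have hNn : n₁ ≤ N := le_of_max_le_left hN
  have hNe : 2 * (galoisRepTorsion W ((p : ℤ) ^ (d + 1))).ker.index + 1 ≤ e' + 1 := by
    have h1 := le_of_max_le_right hN
    have h2 : N < p ^ N := Nat.lt_pow_self hp.one_lt
    omega
  obtain ⟨w, hw, j, hj, hje, hC⟩ := exists_jointValue_convCoeff_ne_zero_of_ne_two W p κ hp2 hirr hns hγ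
    (d + 1) κ' hκ'c hNe φ hφ ψ hψT eW hμ hadd₁ hadd₂ hnondeg
  obtain ⟨_, -, -, -, -, -, -, q, hqS, -, 𝔓, h𝔓, Fr, hFr, -, hφFr, hψFr, hρ, hFrN, hFrN1⟩ :=
    hn₁ N hNn (J := e' + 1) (J' := e' + 1) (by omega) (by omega) (by omega) φ ψ hw S hS
  exact ⟨q, hqS, 𝔓, h𝔓, Fr, hFr, hρ, hFrN, hFrN1, j, by omega, hje, by rw [hφFr, hψFr]; exact hC⟩

end Stub


end Summit.BirchSwinnertonDyer.BirchSwinnertonDyer.Theorems.OneSidedTwistSqueezeX9KatoDivisibilityX9StubKolyvaginPrimePkX9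

end
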